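import Summits.Schanuel.Schanuel.Theorems.ZilberEacSteepestEdgePlaces
import Summits.Schanuel.Schanuel.Theorems.ZilberEacMonicCurvePolyFibres
import HarnessLib

/-!
# Arbitrary base branches, LXI: POLYNOMIAL FIBRES OVER MONIC PLANE CURVES WITHOUT A PLACE
# HYPOTHESIS — Mantova–Masser's question decided from the Newton polygon at infinity

HONEST FRAMING.  Cell `pub-schanuel` (Zilber's Exponential-Algebraic Closedness, case ladder;
host summit Schanuel), seat 2, gen 31.  File LIV proved: `F ∈ ℂ[x₀][x₁]` monic irreducible of
`x₁`-degree `≥ 2`, a place at infinity `x₀ = s^{-k}`, `x₁ = Φ(s)s^{-M}` with a good direction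
`Re(Φ(0)z^M) ≠ 0`, `z^k = 2πi` ⟹ for every `R ∈ ℂ[x₀, x₁]` not vanishing on the curve the surface
`{F(x₀, x₁) = 0, y₀ = R(x₀, x₁)}` is in Mantova–Masser's case (dim-pi-S-1-free) AND has Zariski-dense
exponential points.  Files LX (a)/(b) construct the place.  Hence, with NO place hypothesis:
* **`unprojectedDensityQuestion_monicCurve_polyFibre_of_weightedTopRow`** — any weights `(k, M)`,
  `k, M ≥ 1`, any `Q(s, t) = F(s^k, s^M t)`, a root `θ` of the top row of `Q` with a good direction
  `Re(θ z^M) ≠ 0`, `z^k = 2πi`: case ∧ dense for every `R` (every edge of the Newton polygon at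
  infinity, not only the steepest);
* **`unprojectedDensityQuestion_monicCurve_polyFibre_of_edgeRoot`** — the steepest edge:
  `k deg f_j ≤ M(n - j)` for `j < n`, `θ` a root of `E(t) = Σ_{k deg f_j = M(n-j)} lc(f_j) t^j` with
  a good direction: case ∧ dense for every `R`;
* **`unprojectedDensityQuestion_monicCurve_polyFibre_of_steepestEdge_not_dvd`** — if moreover
  `k ∤ 2M` and the edge is attained at some `j < n`, NO direction hypothesis: case ∧ dense for
  every `R` — a criterion on the ROW DEGREES of `F` alone;
* **`exists_place_monicCurve_polyFibre_germ`** — the dichotomy behind it: every monic irreducible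
  `F` of `x₁`-degree `≥ 2` carries a place at infinity with `x₁ → ∞` (file LX (b)), so the ONLY
  remaining hypothesis over monic curves is the direction datum of some such place.
Decided instances of an OPEN question (Mantova–Masser, PLMS 2024 §1 p. 5); EC(3,2) OPEN; NOT
Schanuel's conjecture (neither used nor implied); EAC ⇏ SC.
-/

noncomputable section

open Filter Topology Set Complex Polynomial
open Literature.NumberTheory.Transcendental Literature.ModelTheory.Zilber
open Literature.ModelTheory.ExponentialFields

set_option linter.dupNamespace false

namespace Summit.Schanuel.Schanuel.Theorems

section MonicCurveAll

variable (F : ℂ[X][X])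

/-- **Every edge of the Newton polygon at infinity with a good direction decides the question.**
`F` monic irreducible of `x₁`-degree `≥ 2`; weights `(k, M)`, `k, M ≥ 1`; any `Q ∈ ℂ[s][t]` with
`Q(s, t) = F(s^k, s^M t)`, rows of degree `≤ N`, top row `T ≠ 0`; a root `θ` of `T` with
`Re(θ z^M) ≠ 0` for some `z^k = 2πi`; `R` nonzero somewhere on the curve: the surface
`{F(x₀, x₁) = 0, y₀ = R(x₀, x₁)}` is in Mantova–Masser's case and has Zariski-dense exponential
points. [cite: MantovaMasser2023, §1 Further remarks, p. 5 (the question, open in general)] (new) -/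
theorem unprojectedDensityQuestion_monicCurve_polyFibre_of_weightedTopRow (hFm : F.Monic)
    (hFirr : Irreducible F) (hn : 2 ≤ F.natDegree) {k M : ℕ} (hk : 1 ≤ k) (hM : 1 ≤ M)
    (Q : ℂ[X][X])
    (hQ : ∀ s t : ℂ, (Q.map (Polynomial.evalRingHom s)).eval t =
      (F.map (Polynomial.evalRingHom (s ^ k))).eval (s ^ M * t))
    (N : ℕ) (hN : ∀ j, (Q.coeff j).natDegree ≤ N) (T : ℂ[X]) (hT : ∀ j, T.coeff j = (Q.coeff j).coeff N)
    (hT0 : T ≠ 0) {θ : ℂ} (hTθ : T.IsRoot θ)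
    (hdir : ∃ z : ℂ, z ^ k = 2 * Real.pi * I ∧ (θ * z ^ M).re ≠ 0)
    (R : MvPolynomial (Fin 2) ℂ)
    (hR : ∃ x y : ℂ, (F.map (Polynomial.evalRingHom x)).eval y = 0 ∧ MvPolynomial.eval ![x, y] R ≠ 0) :
    MMCaseDimPiOneFree {w : Fin 2 ⊕ Fin 2 → ℂ |
        (F.map (Polynomial.evalRingHom (w (Sum.inl 0)))).eval (w (Sum.inl 1)) = 0 ∧
        w (Sum.inr 0) = MvPolynomial.eval ![w (Sum.inl 0), w (Sum.inl 1)] R} ∧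
      UnprojectedDense {w : Fin 2 ⊕ Fin 2 → ℂ |
        (F.map (Polynomial.evalRingHom (w (Sum.inl 0)))).eval (w (Sum.inl 1)) = 0 ∧
        w (Sum.inr 0) = MvPolynomial.eval ![w (Sum.inl 0), w (Sum.inl 1)] R} := by
  obtain ⟨e, Φ, he, hΦan, hΦ0, hplace⟩ := exists_place_of_weightedTopRow F
    (exists_bezout_derivative hFirr (by omega)) hk M Q hQ N hN T hT hT0 hTθ
  have hdir' := exists_direction_mul he hdir
  rw [← hΦ0] at hdir'
  exact unprojectedDensityQuestion_monicCurve_polyFibre F hFm hFirr hn (Nat.mul_le_mul he hk)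
    (Nat.mul_le_mul he hM) hΦan hplace hdir' R hR

/-- **The steepest edge with a good direction decides the question.**  `F` monic irreducible of
`x₁`-degree `n ≥ 2`; weights `(k, M)`, `k, M ≥ 1`, with `k·deg f_j ≤ M(n - j)` for all `j < n`;
`θ` a root of the edge polynomial `E(t) = Σ_{k deg f_j = M(n-j)} lc(f_j) t^j` with `Re(θ z^M) ≠ 0`
for some `z^k = 2πi`; `R` nonzero somewhere on the curve: case ∧ dense.
[cite: MantovaMasser2023, §1 Further remarks, p. 5 (the question, open in general)] (new) -/
theorem unprojectedDensityQuestion_monicCurve_polyFibre_of_edgeRoot (hFm : F.Monic)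
    (hFirr : Irreducible F) (hn : 2 ≤ F.natDegree) {k M : ℕ} (hk : 1 ≤ k) (hM : 1 ≤ M)
    (hmax : ∀ j, j < F.natDegree → (F.coeff j).natDegree * k ≤ M * (F.natDegree - j))
    {E : ℂ[X]} (hE : ∀ j, E.coeff j =
      if (F.coeff j).natDegree * k = M * (F.natDegree - j) then (F.coeff j).leadingCoeff else 0)
    {θ : ℂ} (hEθ : E.IsRoot θ) (hdir : ∃ z : ℂ, z ^ k = 2 * Real.pi * I ∧ (θ * z ^ M).re ≠ 0)
    (R : MvPolynomial (Fin 2) ℂ)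
    (hR : ∃ x y : ℂ, (F.map (Polynomial.evalRingHom x)).eval y = 0 ∧ MvPolynomial.eval ![x, y] R ≠ 0) :
    MMCaseDimPiOneFree {w : Fin 2 ⊕ Fin 2 → ℂ |
        (F.map (Polynomial.evalRingHom (w (Sum.inl 0)))).eval (w (Sum.inl 1)) = 0 ∧
        w (Sum.inr 0) = MvPolynomial.eval ![w (Sum.inl 0), w (Sum.inl 1)] R} ∧
      UnprojectedDense {w : Fin 2 ⊕ Fin 2 → ℂ |
        (F.map (Polynomial.evalRingHom (w (Sum.inl 0)))).eval (w (Sum.inl 1)) = 0 ∧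
        w (Sum.inr 0) = MvPolynomial.eval ![w (Sum.inl 0), w (Sum.inl 1)] R} := by
  obtain ⟨e, Φ, he, hΦan, hΦ0, hplace⟩ := exists_place_of_edgeRoot F hFm
    (exists_bezout_derivative hFirr (by omega)) hk hmax hE hEθ
  have hdir' := exists_direction_mul he hdir
  rw [← hΦ0] at hdir'
  exact unprojectedDensityQuestion_monicCurve_polyFibre F hFm hFirr hn (Nat.mul_le_mul he hk)
    (Nat.mul_le_mul he hM) hΦan hplace hdir' R hR

/-- **A criterion on the row degrees alone.**  `F` monic irreducible of `x₁`-degree `n ≥ 2`;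
weights `(k, M)`, `k ≥ 1`, with `k·deg f_j ≤ M(n - j)` for all `j < n`, equality at some `j < n`
with `f_j ≠ 0`, and `k ∤ 2M`: for EVERY `R ∈ ℂ[x₀, x₁]` nonzero somewhere on the curve, the
surface `{F(x₀, x₁) = 0, y₀ = R(x₀, x₁)}` is in Mantova–Masser's case and has Zariski-dense
exponential points (the nonzero root of the edge polynomial; three `k`-th roots of `2πi` contain a
good direction, file XX). [cite: MantovaMasser2023, §1 Further remarks, p. 5 (the question, open in
general)] (new) -/
theorem unprojectedDensityQuestion_monicCurve_polyFibre_of_steepestEdge_not_dvd (hFm : F.Monic)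
    (hFirr : Irreducible F) (hn : 2 ≤ F.natDegree) {k M : ℕ} (hk : 1 ≤ k)
    (hmax : ∀ j, j < F.natDegree → (F.coeff j).natDegree * k ≤ M * (F.natDegree - j))
    (hatt : ∃ j, j < F.natDegree ∧ F.coeff j ≠ 0 ∧
      (F.coeff j).natDegree * k = M * (F.natDegree - j))
    (hkM : ¬ k ∣ 2 * M) (R : MvPolynomial (Fin 2) ℂ)
    (hR : ∃ x y : ℂ, (F.map (Polynomial.evalRingHom x)).eval y = 0 ∧ MvPolynomial.eval ![x, y] R ≠ 0) :
    MMCaseDimPiOneFree {w : Fin 2 ⊕ Fin 2 → ℂ |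
        (F.map (Polynomial.evalRingHom (w (Sum.inl 0)))).eval (w (Sum.inl 1)) = 0 ∧
        w (Sum.inr 0) = MvPolynomial.eval ![w (Sum.inl 0), w (Sum.inl 1)] R} ∧
      UnprojectedDense {w : Fin 2 ⊕ Fin 2 → ℂ |
        (F.map (Polynomial.evalRingHom (w (Sum.inl 0)))).eval (w (Sum.inl 1)) = 0 ∧
        w (Sum.inr 0) = MvPolynomial.eval ![w (Sum.inl 0), w (Sum.inl 1)] R} := by
  obtain ⟨θ, e, Φ, hθ0, he, hΦan, hΦ0, hplace⟩ := exists_place_of_steepestEdge F hFm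
    (exists_bezout_derivative hFirr (by omega)) hk hmax hatt
  have hM : 1 ≤ M := by
    rcases Nat.eq_zero_or_pos M with h | h
    · exact absurd (by rw [h, mul_zero]; exact dvd_zero k) hkM
    · exact h
  have hdir' := exists_direction_mul he (exists_direction_of_not_dvd hk hkM hθ0)
  rw [← hΦ0] at hdir'
  exact unprojectedDensityQuestion_monicCurve_polyFibre F hFm hFirr hn (Nat.mul_le_mul he hk)
    (Nat.mul_le_mul he hM) hΦan hplace hdir' R hR

/-- **The dichotomy behind it: only the direction datum remains.**  For every monic irreducible
`F` of `x₁`-degree `≥ 2` and every `R` nonzero somewhere on the curve there is a place at infinity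
`x₀ = s^{-k}`, `x₁ = Φ(s)s^{-M}` (`k, M ≥ 1`, `Φ(0) ≠ 0`) along which the surface
`{F = 0, y₀ = R}` carries the germ `(x₀(s), x₁(s), ψ(s)s^L, e^{x₁(s)})` with `ψ(0) ≠ 0` — the
input of the growth engine of file XXXII, which then needs only `Re(Φ(0)z^M) ≠ 0` for some
`z^k = 2πi`. [folklore] (new in this form) -/
theorem exists_place_monicCurve_polyFibre_germ (hFm : F.Monic) (hFirr : Irreducible F)
    (hn : 2 ≤ F.natDegree) (R : MvPolynomial (Fin 2) ℂ)
    (hR : ∃ x y : ℂ, (F.map (Polynomial.evalRingHom x)).eval y = 0 ∧ MvPolynomial.eval ![x, y] R ≠ 0) :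
    ∃ (k M : ℕ) (Φ ψ : ℂ → ℂ) (L : ℤ), 1 ≤ k ∧ 1 ≤ M ∧ AnalyticAt ℂ Φ 0 ∧ Φ 0 ≠ 0 ∧
      AnalyticAt ℂ ψ 0 ∧ ψ 0 ≠ 0 ∧
      ∀ᶠ s in 𝓝[≠] (0 : ℂ),
        (F.map (Polynomial.evalRingHom (s ^ k)⁻¹)).eval (Φ s * (s ^ M)⁻¹) = 0 ∧
        MvPolynomial.eval ![(s ^ k)⁻¹, Φ s * (s ^ M)⁻¹] R = ψ s * s ^ L := by
  obtain ⟨k, M, Φ, hk, hM, hΦan, hΦ0, hplace⟩ := exists_place_atInfinity_of_monic F hFm hFirr hn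
  obtain ⟨G, hGdeg, hGev⟩ := exists_rows_reduction_monic F hFm (by omega) R
  have hG0 : G ≠ 0 := by
    intro hG
    obtain ⟨x, y, hxy, hxR⟩ := hR
    apply hxR
    rw [hGev x y hxy, hG, Polynomial.map_zero, Polynomial.eval_zero]
  obtain ⟨ψ, L, hψan, hψ0, hf⟩ := exists_place_normalForm F hFm hFirr G hG0 hGdeg hk M hΦan hplace
  refine ⟨k, M, Φ, ψ, L, hk, hM, hΦan, hΦ0, hψan, hψ0, ?_⟩
  filter_upwards [hplace, hf] with s hs hfs
  exact ⟨hs, by rw [hGev _ _ hs, hfs]⟩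

end MonicCurveAll

end Summit.Schanuel.Schanuel.Theorems

end
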